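import Literature.Computability.Complexity.CodeFPListKit
import Literature.Computability.Complexity.CodeFPBudgets
import Summits.PneNP.PneNP.Theorems.Nc03AvoidResidualCoreCandFewHeadsRungFP
import Summits.PneNP.PneNP.Theorems.MajLocalAvoidFPDecode

/-!
# F-N2a FP wrapper, part 2/2: pure `MAJ_k` range avoidance at linear stretch is in FP (`LocalAvoidLinearFP k (IsPure majPred)`)

Cell pnp-ideate, ROUND-17 rung F-N2a (`--supports stmt-PneNP-19007`).  `LtfLocalAvoidCore` proved the
combinatorial half: for a pure `MAJ_k` instance `I` (`k` odd) with `m > k²·n` outputs the ONE-PASS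
GREEDY bit-string `greedyBits I` lies outside `Range(I)` (`greedyBits_not_mem_range`).  With the decoder of
part 1 (`MajLocalAvoidFPDecode.rowsTok_toks`), this part is the machine:

* GREEDY PASS as a context-free left fold over the rows (`sigRun`): the state is the list of already
  signed rows; the correlation of the next row is RECOMPUTED from it (`loadOf`, `corrOf` — no array
  updates), and the new bit is `[0 < correlation]` (= sign `-1`).  `sigRun_invariant` identifies the
  loads with `LtfLocalAvoidCore.greedyAux` and the bits with `LtfLocalAvoidCore.greedyBits`, whence
  `readOut_majStr : readOut m (majStr k (encode I)) = greedyBits I`.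
* TYPING in the `CodeFP` algebra (`codeFP_runs` of `Nc03AvoidResidualCoreCandFewHeadsRungFP`, `map`,
  `foldl₀` with the linear accumulator bound `length_stE_le`, `intSum`, `rawCountNat`, `bitsToStr`)
  ⇒ `isPolyTime_majStr`.
* RUNG `maj_rungFP : Odd k → LocalAvoidLinearFP k (fun _ _ I => I.IsPure (majPred k))` with `C = k² + 1`.

Placement (honest): a restricted-model algorithmic rung of the range-avoidance ladder (one predicate,
linear stretch; print: [KuntewarSarma2025, Thm. 6] needs `m > n²` for one-intersecting `MAJ_k`, Thm. 8
covers monotone `k = 3` at `m > n`); it says nothing about `P` versus `NP`.  General LTF tables (the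
per-`k` certificate table feeding `LtfGreedySigning.greedyBitsW`) are NOT treated here.
-/

set_option linter.dupNamespace false -- `Summit.PneNP.PneNP.…`: summit = sub-problem name (D-0017 single-conjunct layout)

namespace Summit.PneNP.PneNP.Theorems.MajLocalAvoidFP

open Literature.Computability.Complexity
open Summit.PneNP.PneNP.Theorems.Nc03AvoidResidualCoreCandFewHeadsRungFP
open Summit.PneNP.PneNP.Theorems.LtfLocalAvoidCore

variable {k n m : ℕ}

/-! ## The greedy pass as a fold over the rows -/

/-- The load that the signed rows `st` put on position `w` (`Σ sign · multiplicity`). -/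
def loadOf (st : List (Bool × List ℕ)) (w : ℕ) : ℤ := (st.map fun p => sgnZ p.1 * (p.2.count w : ℤ)).sum

/-- Correlation of a row with the current loads. -/
def corrOf (st : List (Bool × List ℕ)) (row : List ℕ) : ℤ := (row.map (loadOf st)).sum

/-- One greedy step: append the row, signed AGAINST its correlation (bit `true` = sign `-1`). -/
def sigStep (row : List ℕ) (st : List (Bool × List ℕ)) : List (Bool × List ℕ) :=
  st ++ [(decide (0 < corrOf st row), row)]

/-- The signed rows after the one pass. -/
def sigRun (vs : List (List ℕ)) : List (Bool × List ℕ) := vs.foldl (fun st row => sigStep row st) []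

/-- The greedy bits of a list of rows. -/
def greedyRows (vs : List (List ℕ)) : List Bool := (sigRun vs).map Prod.fst

/-- **THE MACHINE**: tokenize the code, read the rows, run the greedy pass, print the bits. -/
def majStr (k : ℕ) (w : List Bool) : List Bool := greedyRows (rowsTok k (runs w))

/-- The pass keeps the rows (it only attaches a bit to each). -/
theorem map_snd_foldl_sigStep (l : List (List ℕ)) : ∀ st₀ : List (Bool × List ℕ),
    (l.foldl (fun st row => sigStep row st) st₀).map Prod.snd = st₀.map Prod.snd ++ l := by
  induction l with
  | nil => intro st₀; simp
  | cons r l ih =>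
    intro st₀
    rw [List.foldl_cons, ih, sigStep, List.map_append, List.map_cons, List.map_nil, List.append_assoc,
      List.singleton_append]

/-- Adding a signed row adds its signed multiplicities to the loads. -/
theorem loadOf_append_singleton (st : List (Bool × List ℕ)) (b : Bool) (r : List ℕ) (w : ℕ) :
    loadOf (st ++ [(b, r)]) w = loadOf st w + sgnZ b * (r.count w : ℤ) := by
  simp [loadOf, List.map_append, List.sum_append]

/-- Counting in an `ofFn` list = the number of indices hitting the value. -/
theorem count_ofFn_eq_sum : ∀ (k : ℕ) (f : Fin k → ℕ) (a : ℕ),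
    ((List.ofFn f).count a : ℤ) = ∑ i : Fin k, if f i = a then (1 : ℤ) else 0
  | 0, f, a => by simp
  | k + 1, f, a => by
    rw [List.ofFn_succ, List.count_cons, Fin.sum_univ_succ, Nat.cast_add, count_ofFn_eq_sum k _ a, add_comm]
    congr 1
    by_cases h : f 0 = a <;> simp [h]

/-- The multiplicity of a position in a row is `LtfLocalAvoidCore.mult`. -/
theorem count_rowOf (I : LocalMap k n m) (j : Fin m) (w : Fin n) : ((rowOf I j).count w.val : ℤ) = mult I j w := by
  rw [rowOf, count_ofFn_eq_sum, mult]
  refine Finset.sum_congr rfl fun i _ => ?_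
  simp [Fin.ext_iff]

/-- The greedy bit read as a sign is the greedy sign. -/
theorem sgnZ_greedyBits (I : LocalMap k n m) (j : Fin m) : sgnZ (greedyBits I j) = greedySign I j := by
  unfold greedyBits
  rcases greedySign_cases I j with h | h <;> simp [h, sgnZ]

/-- The greedy bit is `[0 < correlation]`. -/
theorem greedyBits_eq_decide (I : LocalMap k n m) (j : Fin m) :
    greedyBits I j = decide (0 < ∑ w : Fin n, greedyAux I j.val w * mult I j w) := by
  unfold greedyBits greedySign pickSign
  split_ifs with h <;> simp [h]

/-- With the right loads, the machine's correlation of row `t` is the greedy correlation of output `t`. -/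
theorem corrOf_rowOf {st : List (Bool × List ℕ)} (I : LocalMap k n m) (t : Fin m)
    (hload : ∀ w : Fin n, loadOf st w.val = greedyAux I t.val w) :
    corrOf st (rowOf I t) = ∑ w : Fin n, greedyAux I t.val w * mult I t w := by
  have hl : corrOf st (rowOf I t) = ∑ i : Fin k, greedyAux I t.val (I.vars t i) := by
    rw [corrOf, rowOf, List.map_ofFn, List.sum_ofFn]
    exact Finset.sum_congr rfl fun i _ => hload (I.vars t i)
  rw [hl]
  unfold mult
  simp_rw [Finset.mul_sum, mul_ite, mul_one, mul_zero]
  rw [Finset.sum_comm]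
  refine Finset.sum_congr rfl fun i _ => ?_
  rw [Finset.sum_ite_eq]
  simp

/-- Row `j` as an `ℕ`-indexed function (empty past `m`). -/
def rowAt (I : LocalMap k n m) (j : ℕ) : List ℕ := if h : j < m then rowOf I ⟨j, h⟩ else []

/-- The greedy bit of output `j` as an `ℕ`-indexed function (`false` past `m`). -/
def bitAt (I : LocalMap k n m) (j : ℕ) : Bool := if h : j < m then greedyBits I ⟨j, h⟩ else false

/-- The rows listed by index. -/
theorem rows_eq (I : LocalMap k n m) : rows I = (List.range m).map (rowAt I) := by
  rw [rows, ← List.map_coe_finRange_eq_range, List.map_map]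
  refine List.map_congr_left fun j _ => ?_
  simp [rowAt, j.isLt]

/-- **THE INVARIANT of the pass**: after the first `t` rows the state is those rows signed by the greedy
bits of `LtfLocalAvoidCore`, and its loads are the greedy loads `greedyAux I t`. -/
theorem sigRun_invariant (I : LocalMap k n m) : ∀ t, t ≤ m →
    ((List.range t).map (rowAt I)).foldl (fun st row => sigStep row st) [] =
        (List.range t).map (fun j => (bitAt I j, rowAt I j)) ∧
      ∀ w : Fin n, loadOf (((List.range t).map (rowAt I)).foldl (fun st row => sigStep row st) []) w.val =
        greedyAux I t w := by
  intro t
  induction t with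
  | zero => intro _; simp [loadOf, greedyAux]
  | succ t ih =>
    intro ht
    have h : t < m := Nat.lt_of_succ_le ht
    obtain ⟨ih1, ih2⟩ := ih h.le
    have hrow : rowAt I t = rowOf I ⟨t, h⟩ := dif_pos h
    have hbit : bitAt I t = greedyBits I ⟨t, h⟩ := dif_pos h
    have hstep : ((List.range (t + 1)).map (rowAt I)).foldl (fun st row => sigStep row st) [] =
        ((List.range t).map (rowAt I)).foldl (fun st row => sigStep row st) [] ++ [(bitAt I t, rowAt I t)] := by
      rw [List.range_succ, List.map_append, List.foldl_append, List.map_singleton, List.foldl_cons,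
        List.foldl_nil, sigStep, hrow, corrOf_rowOf I ⟨t, h⟩ ih2, hbit, greedyBits_eq_decide]
    refine ⟨?_, fun w => ?_⟩
    · rw [hstep, ih1, List.range_succ, List.map_append, List.map_singleton]
    · rw [hstep, loadOf_append_singleton, ih2, hbit, hrow, sgnZ_greedyBits, count_rowOf, greedyAux_succ I t h]

/-- **The machine's greedy bits are the greedy bits of `LtfLocalAvoidCore`.** -/
theorem greedyRows_rows (I : LocalMap k n m) : greedyRows (rows I) = (List.range m).map (bitAt I) := by
  rw [greedyRows, sigRun, rows_eq, (sigRun_invariant I m le_rfl).1, List.map_map]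
  rfl

/-- **On the code of an all-`MAJ_k` instance (`k ≥ 1`) the machine prints the greedy bits.** -/
theorem majStr_encode {I : LocalMap k n m} (hI : ∀ j, I.table j = majPred k) (hk : 0 < k) :
    majStr k I.encode = (List.range m).map (bitAt I) := by
  rw [majStr, runs_encode hI hk, rowsTok_toks, greedyRows_rows]

/-- **The answer read off the machine's output is `greedyBits I`.** -/
theorem readOut_majStr {I : LocalMap k n m} (hI : ∀ j, I.table j = majPred k) (hk : 0 < k) :
    readOut m (majStr k I.encode) = greedyBits I := by
  funext j
  rw [readOut, majStr_encode hI hk, List.getD_eq_getElem?_getD, List.getElem?_map,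
    List.getElem?_range j.isLt]
  simp [bitAt, j.isLt]

/-! ## `majStr` is polynomial time: assembly in the typed `CodeFP` algebra -/

section PolyTime

open CodeFP Polynomial

/-- Code of a row (binary numerals). -/
abbrev rowE : List ℕ → List Bool := rawE natE

/-- Code of a signed row. -/
abbrev sgE : Bool × List ℕ → List Bool := pairE bitE rowE

/-- Code of the state of the pass. -/
abbrev stE : List (Bool × List ℕ) → List Bool := rawE sgE

/-- The load of a position is polynomial time. -/
theorem codeFP_loadOf : CodeFP (pairE natE stE) intE (fun p => loadOf p.2 p.1) := by
  have hcnt : CodeFP (pairE natE sgE) intE (fun t => ((t.2.2.count t.1 : ℕ) : ℤ)) :=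
    (intOfNat.comp (rawCountNat.comp ((fst natE sgE).pair (snd natE sgE).snd'))).congr fun _ => rfl
  have hg : CodeFP (pairE natE sgE) intE (fun t => sgnZ t.2.1 * (t.2.2.count t.1 : ℤ)) :=
    ((snd natE sgE).fst'.ite (intNeg.comp hcnt) hcnt).congr fun t => by
      obtain ⟨w, b, r⟩ := t
      cases b <;> simp [sgnZ]
  exact (intSum.comp (map hg)).congr fun _ => rfl

/-- The correlation of a row is polynomial time. -/
theorem codeFP_corrOf : CodeFP (pairE stE rowE) intE (fun p => corrOf p.1 p.2) := by
  have hg : CodeFP (pairE stE natE) intE (fun t => loadOf t.1 t.2) :=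
    (codeFP_loadOf.comp ((snd stE natE).pair (fst stE natE))).congr fun _ => rfl
  exact (intSum.comp (map hg)).congr fun _ => rfl

/-- One step of the pass is polynomial time. -/
theorem codeFP_sigStep : CodeFP (pairE rowE stE) stE (fun t => sigStep t.1 t.2) := by
  have hcorr : CodeFP (pairE rowE stE) intE (fun t => corrOf t.2 t.1) :=
    (codeFP_corrOf.comp ((snd rowE stE).pair (fst rowE stE))).congr fun _ => rfl
  have hbit : CodeFP (pairE rowE stE) bitE (fun t => decide (0 < corrOf t.2 t.1)) :=
    (intLt.comp ((const (pairE rowE stE) (0 : ℤ)).pair hcorr)).congr fun _ => rfl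
  have hitem : CodeFP (pairE rowE stE) sgE (fun t => (decide (0 < corrOf t.2 t.1), t.1)) :=
    hbit.pair (fst rowE stE)
  exact ((rawAppend sgE).comp ((snd rowE stE).pair ((rawSingleton sgE).comp hitem))).congr fun _ => rfl

/-- The code of a state is linear in the code of its rows. -/
theorem length_stE_le : ∀ st : List (Bool × List ℕ), (stE st).length ≤ 5 * (rawE rowE (st.map Prod.snd)).length
  | [] => by simp
  | (b, r) :: st => by
    have ih := length_stE_le st
    show (rawE sgE ((b, r) :: st)).length ≤ 5 * (rawE rowE (((b, r) :: st).map Prod.snd)).length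
    rw [List.map_cons, rawE_cons, rawE_cons, length_boolPair, length_boolPair]
    show 2 * (pairE bitE rowE (b, r)).length + 2 + (stE st).length ≤ _
    rw [pairE_apply, length_boolPair]
    simp only [bitE, List.length_singleton]
    omega

/-- The pass is polynomial time (the state stays linear in the input). -/
theorem codeFP_sigRun : CodeFP (rawE rowE) stE sigRun := by
  have h := foldl₀ (eα := rowE) (eβ := stE) (step := sigStep) (b₀ := ([] : List (Bool × List ℕ)))
    codeFP_sigStep (5 * X) (fun l₁ l₂ => by
      have h1 := length_stE_le (l₁.foldl (fun st row => sigStep row st) [])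
      rw [map_snd_foldl_sigStep, List.map_nil, List.nil_append] at h1
      have h2 : (rawE rowE l₁).length ≤ (rawE rowE (l₁ ++ l₂)).length :=
        length_rawE_le_of_sublist rowE (List.sublist_append_left l₁ l₂)
      simp only [eval_mul, eval_ofNat, eval_X]
      omega)
  exact h.congr fun _ => rfl

/-- The greedy bits of a list of rows are polynomial time. -/
theorem codeFP_greedyRows : CodeFP (rawE rowE) (rawE bitE) greedyRows :=
  ((map₀ (fst bitE rowE)).comp codeFP_sigRun).congr fun _ => rfl

/-- Reading one position off the tokens is polynomial time. -/
theorem codeFP_varTok (k : ℕ) :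
    CodeFP (pairE (pairE (rawE unE) natE) natE) natE (fun p => varTok k p.1.1 p.1.2 p.2) := by
  have hj : CodeFP (pairE (pairE (rawE unE) natE) natE) natE (fun p => p.1.2) := (fst _ _).snd'
  have hi : CodeFP (pairE (pairE (rawE unE) natE) natE) natE (fun p => p.2) := snd _ _
  have hts : CodeFP (pairE (pairE (rawE unE) natE) natE) (rawE unE) (fun p => p.1.1) := (fst _ _).fst'
  have hidx : CodeFP (pairE (pairE (rawE unE) natE) natE) natE
      (fun p => (tabLen k + k) * p.1.2 + 2 + (tabLen k + p.2)) :=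
    natAdd.comp ((natAdd.comp ((natMul.comp ((const _ (tabLen k + k)).pair hj)).pair (const _ (2 : ℕ)))).pair
      (natAdd.comp ((const _ (tabLen k)).pair hi)))
  have htok : CodeFP (pairE (pairE (rawE unE) natE) natE) natE
      (fun p => p.1.1.getD ((tabLen k + k) * p.1.2 + 2 + (tabLen k + p.2)) 0) :=
    natOfUn.comp (codeFP_getTok.comp (hts.pair hidx))
  have hoff : CodeFP (pairE (pairE (rawE unE) natE) natE) natE (fun p => if p.2 = 0 then tabTail k else 0) :=
    ((natEq.comp (hi.pair (const _ (0 : ℕ)))).ite (const _ (tabTail k)) (const _ (0 : ℕ))).congr fun p => by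
      by_cases h : p.2 = 0 <;> simp [h]
  exact (natSub.comp (htok.pair hoff)).congr fun _ => rfl

/-- Reading one row off the tokens is polynomial time. -/
theorem codeFP_rowTok (k : ℕ) : CodeFP (pairE (rawE unE) natE) rowE (fun p => rowTok k p.1 p.2) :=
  ((map (codeFP_varTok k)).comp ((CodeFP.id _).pair (const _ (List.range k)))).congr fun _ => rfl

/-- Reading all rows off the tokens is polynomial time. -/
theorem codeFP_rowsTok (k : ℕ) : CodeFP (rawE unE) (rawE rowE) (rowsTok k) :=
  ((map (codeFP_rowTok k)).comp ((CodeFP.id _).pair (urange.comp codeFP_mTok))).congr fun _ => rfl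

/-- **The machine is computed on codes by an `FP` string function** (plain strings in and out). -/
theorem codeFP_majStr (k : ℕ) : CodeFP strE strE (majStr k) :=
  (bitsToStr.comp (codeFP_greedyRows.comp ((codeFP_rowsTok k).comp codeFP_runs))).congr fun _ => rfl

/-- **`majStr k ∈ FP`.** -/
theorem majStr_mem_FP (k : ℕ) : majStr k ∈ FP := by
  obtain ⟨f, hf, hfw⟩ := codeFP_majStr k
  have h : f = majStr k := funext fun w => hfw w
  rw [← h]
  exact hf

/-- **`majStr k` is polynomial-time computable** in the sense of `LocalAvoidLinearFP` (`IsPolyTime`). -/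
theorem isPolyTime_majStr (k : ℕ) : IsPolyTime (majStr k) := (isPolyTime_iff (majStr k)).mpr (majStr_mem_FP k)

end PolyTime

/-! ## The rung -/

/-- **F-N2a for pure `MAJ_k`, literally typed**: for every odd `k`, `NC⁰ₖ` range avoidance restricted to
PURE `MAJ_k` instances (one predicate, `k` distinct positions per output) is solved at linear stretch
`m ≥ (k² + 1)·n` by ONE polynomial-time string function — the one-pass greedy signing.  (Restricted-model
algorithmic rung of the range-avoidance ladder; no bearing on `P ≠ NP`.) -/
theorem maj_rungFP (k : ℕ) (hk : Odd k) : LocalAvoidLinearFP k (fun _ _ I => I.IsPure (majPred k)) := by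
  refine ⟨k ^ 2 + 1, majStr k, isPolyTime_majStr k, fun n m I hI hn hm => ?_⟩
  rw [readOut_majStr hI.1 hk.pos]
  refine greedyBits_not_mem_range hk I hI ?_
  rw [Nat.add_mul, Nat.one_mul] at hm
  omega

end Summit.PneNP.PneNP.Theorems.MajLocalAvoidFP
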